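/-
Copyright (c) 2026. All rights reserved.
Released under Apache 2.0 license as described in the file LICENSE.
-/
import Literature.Probability.FitznerVanDerHofstad2017.SrwTrigMajorantClassRows
import HarnessLib

/-!
# Closing the KU-SEP cell rows into rational atoms: the `K_{n,0}` row from the class `[0]`, and the
# `ℚ`-cast Cauchy–Schwarz closures for the odd-`l` and `T` atoms

Support module (d-generic, number-free, definition-free).  The per-cell rows of the KU-SEP chain
(`SrwTrigMajorantClassRows`: `srwK_two_le_gset_classEncl_cast`, `srwU_zero_le_gset_classEncl_cast`,
`srwU_two_le_gset_classEncl_cast`; `SrwTrigMajorantKM2EvenRow`) conclude `F(x) ≤ ((q : ℚ) : ℝ)` for the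
EVEN-`l` functionals `F ∈ {K_{n,2}, U_{n,0}, U_{n,2}, KM₂_{n,0}}` from rational enclosures of pure cosine-class
twisted moments.  This file supplies the remaining closures an assembler of cell ATOMS needs, once, for
general `d`:

* `srwK_zero_le_gset_classEncl_cast` — the `K_{n,0}` cell (`l = 0`, weight `|D̂|⁰ = 1`) directly from
  enclosures of the class `[0] = 1` (the plain twisted seeds `Tw_n(x;β)` with the unit weight written
  `fun _ => 1`, the shape the seed certificates deliver), the `β = 0` mass and a rational `Sq`-bound;
* `integral_abs_Dhat_pow_add_mul_le_sqrt` — log-convexity in the exponent `l` of `∫ |D̂|^l G` for a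
  non-negative weight `G` (Cauchy–Schwarz in the one-factor / AM–GM form of `SrwIntegralTOneFactorCS`),
  and its instances `srwK_le_sqrt_srwK_mul_srwK`, `srwU_le_sqrt_srwU_mul_srwU`,
  `srwKM2_le_sqrt_srwKM2_mul_srwKM2`: `F_{n,l₁+l₂}(x) ≤ √F_{n,2l₁}(x) · √F_{n,2l₂}(x)` at the SAME node `x`
  (so the odd-`l` atoms `K_{n,2j+1}(x)`, `U_{n,2j+1}(x)` follow from the certified even-`l` cells at `x`);
* the `ℚ`-cast closures `srwK_le_cast_of_even`, `srwU_le_cast_of_even`,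
  `srwKM2_le_cast_of_even`, `srwT_le_cast_of_srwK_srwKM2` (+ the named instances `srwK_odd_le_cast`,
  `srwU_odd_le_cast`, `srwT_zero_le_cast`, `srwT_one_le_cast_left`, `srwT_one_le_cast_right`,
  `srwT_two_le_cast`): from `F₁(x) ≤ a`, `F₂(x) ≤ b` (`a b : ℚ`) and the DECIDABLE side conditions `0 ≤ c`,
  `a · b ≤ c²` conclude `F(x) ≤ ((c : ℚ) : ℝ)` — no `Real.sqrt` is left in an instance module.

All statements are exact inequalities / monotone bookkeeping for general `d`; nothing here is numerical and
nothing is a certificate.  No dimension-specific declaration is introduced.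

References (page and equation numbers refer to the NoBLE companion): [NoBLE17-I] R. Fitzner,
R. van der Hofstad, *Generalized approach to the non-backtracking lace expansion*, Probab. Theory
Relat. Fields 169 (2017) 1041–1119 (arXiv:1506.07969; bib key `FitznerVanDerHofstad2016NoBLE`), (3.36)–(3.38)
p. 1071, §5.1.2 (5.11)–(5.16) pp. 1091–1092, §5.2 (5.9)–(5.11), (5.14) pp. 1091–1092 (the Schwarz-inequality
device, going back to T. Hara, G. Slade, Rev. Math. Phys. 4 (1992), App. B); applied in [FvdH17] R. Fitzner,
R. van der Hofstad, *Mean-field behavior for nearest-neighbor percolation in `d > 10`*, Electron. J. Probab. 22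
(2017) no. 43.
-/

noncomputable section

open MeasureTheory Real Finset
open scoped BigOperators

namespace Literature.Probability.FitznerVanDerHofstad2017

open TrigEncl
open Literature.Barriers.CriticalPhenomena
open Literature.Barriers.CriticalPhenomena.Slade2006Prop53 (P)

variable {d : ℕ}

/-! ### The `K_{n,0}` cell from the class `[0]` -/

/-- **`K_{n,0}(x)` from enclosures of the class `[0] = 1`** (`d ≥ 2n+1`): with the `β = 0` mass
`T₀ ≤ Tw_n(x;0) ≤ T₀'` (`= I_{n,0}(0)`, `srwTwist_one_zero_encl_cast`), a rational bound
`Sq^{|D̂|⁰}_n(x) ≤ Shi` (`srwSqMom_abs_Dhat_pow_zero_single_le_cast` at an axis node) and enclosures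
`l₀ r ≤ Tw_n(x; gsetB r) ≤ h₀ r` of the plain twisted seeds (unit weight `fun _ => 1`), the `K` row of
`srwK_le_gset_encl_cast` at `l = 0` as ONE closed rational expression.
[cite: FitznerVanDerHofstad2016NoBLE, (3.36) p. 1071, §5.1.2 (5.11)–(5.16) pp. 1091–1092, §5.2 (5.9) p. 1092] -/
theorem srwK_zero_le_gset_classEncl_cast {n : ℕ} (hd : 2 * n + 1 ≤ d) (x : Fin d → ℤ)
    {T₀ T₀' Shi : ℚ} {l₀ h₀ : Fin 6 → ℚ}
    (hT0 : (T₀ : ℝ) ≤ srwTwist d n (fun _ => (1 : ℝ)) x 0 ∧ srwTwist d n (fun _ => (1 : ℝ)) x 0 ≤ (T₀' : ℝ))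
    (hS : srwSqMom d n (fun k => |Dhat d k| ^ 0) x ≤ (Shi : ℝ))
    (h0 : ∀ r, (l₀ r : ℝ) ≤ srwTwist d n (fun _ => (1 : ℝ)) x (gsetB r)
      ∧ srwTwist d n (fun _ => (1 : ℝ)) x (gsetB r) ≤ (h₀ r : ℝ)) :
    srwK d n 0 x ≤ ((max (MajCert.gset.B * T₀) (MajCert.gset.B * T₀') + MajCert.gset.c * Shi
      + ∑ r : Fin 6, max (MajCert.gset.a r * l₀ r) (MajCert.gset.a r * h₀ r) : ℚ) : ℝ) := by
  refine srwK_le_gset_encl_cast hd 0 x ?_ hS ?_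
  · simpa only [srwTwist_abs_Dhat_pow_zero] using hT0
  · intro r
    simpa only [srwTwist_abs_Dhat_pow_zero] using h0 r

/-! ### Log-convexity in the exponent `l` (one-factor Cauchy–Schwarz at a fixed node) -/

/-- Pointwise AM–GM: for `p, g ≥ 0` and `λ > 0`, `p^{l₁+l₂} g ≤ (λ p^{2l₁} g + p^{2l₂} g / λ)/2`. [folklore] -/
private theorem pow_add_mul_le_am_gm {p g lam : ℝ} (hp : 0 ≤ p) (hg : 0 ≤ g) (hl : 0 < lam) (l₁ l₂ : ℕ) :
    p ^ (l₁ + l₂) * g ≤ (lam * (p ^ (2 * l₁) * g) + p ^ (2 * l₂) * g / lam) / 2 := by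
  have h := abs_mul_abs_le_am_gm (p ^ l₁) (p ^ l₂) hl
  rw [abs_of_nonneg (pow_nonneg hp l₁), abs_of_nonneg (pow_nonneg hp l₂), ← pow_add, ← pow_mul, ← pow_mul,
    mul_comm l₁ 2, mul_comm l₂ 2] at h
  have h' := mul_le_mul_of_nonneg_right h hg
  refine h'.trans_eq ?_
  ring

/-- **Log-convexity in `l` of `∫ |D̂|^l G` for a weight `G ≥ 0`:**
`(∫ |D̂|^{l₁+l₂} G)/(2π)^d ≤ √((∫ |D̂|^{2l₁} G)/(2π)^d) · √((∫ |D̂|^{2l₂} G)/(2π)^d)` whenever the two right-hand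
integrands are integrable (Cauchy–Schwarz with the split `|D̂|^{l₁}√G · |D̂|^{l₂}√G`). [folklore]
Device of [cite: FitznerVanDerHofstad2016NoBLE, §5.2 (5.9), (5.11) pp. 1091–1092] -/
theorem integral_abs_Dhat_pow_add_mul_le_sqrt {G : (Fin d → ℝ) → ℝ} (hG : ∀ k, 0 ≤ G k) (l₁ l₂ : ℕ)
    (h1 : Integrable (fun k => |Dhat d k| ^ (2 * l₁) * G k) (P d))
    (h2 : Integrable (fun k => |Dhat d k| ^ (2 * l₂) * G k) (P d)) :
    (∫ k, |Dhat d k| ^ (l₁ + l₂) * G k ∂P d) / (2 * π) ^ d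
      ≤ Real.sqrt ((∫ k, |Dhat d k| ^ (2 * l₁) * G k ∂P d) / (2 * π) ^ d)
        * Real.sqrt ((∫ k, |Dhat d k| ^ (2 * l₂) * G k ∂P d) / (2 * π) ^ d) := by
  have hA : 0 ≤ (∫ k, |Dhat d k| ^ (2 * l₁) * G k ∂P d) / (2 * π) ^ d :=
    div_nonneg (integral_nonneg fun k => mul_nonneg (pow_nonneg (abs_nonneg _) _) (hG k)) (two_pi_pow_pos d).le
  have hB : 0 ≤ (∫ k, |Dhat d k| ^ (2 * l₂) * G k ∂P d) / (2 * π) ^ d :=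
    div_nonneg (integral_nonneg fun k => mul_nonneg (pow_nonneg (abs_nonneg _) _) (hG k)) (two_pi_pow_pos d).le
  refine le_sqrt_mul_sqrt_of_forall hA hB fun lam hl => ?_
  have key : ∫ k, |Dhat d k| ^ (l₁ + l₂) * G k ∂P d
      ≤ ∫ k, (lam * (|Dhat d k| ^ (2 * l₁) * G k) + |Dhat d k| ^ (2 * l₂) * G k / lam) / 2 ∂P d :=
    integral_mono_of_nonneg (ae_of_all _ fun k => mul_nonneg (pow_nonneg (abs_nonneg _) _) (hG k))
      (((h1.const_mul lam).add (h2.div_const lam)).div_const 2)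
      (ae_of_all _ fun k => pow_add_mul_le_am_gm (abs_nonneg _) (hG k) hl l₁ l₂)
  have e : ∫ k, (lam * (|Dhat d k| ^ (2 * l₁) * G k) + |Dhat d k| ^ (2 * l₂) * G k / lam) / 2 ∂P d
      = (lam * (∫ k, |Dhat d k| ^ (2 * l₁) * G k ∂P d) + (∫ k, |Dhat d k| ^ (2 * l₂) * G k ∂P d) / lam) / 2 := by
    rw [integral_div, integral_add (h1.const_mul lam) (h2.div_const lam), integral_const_mul, integral_div]
  calc (∫ k, |Dhat d k| ^ (l₁ + l₂) * G k ∂P d) / (2 * π) ^ d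
      ≤ ((lam * (∫ k, |Dhat d k| ^ (2 * l₁) * G k ∂P d) + (∫ k, |Dhat d k| ^ (2 * l₂) * G k ∂P d) / lam) / 2)
          / (2 * π) ^ d :=
        div_le_div_of_nonneg_right (key.trans_eq e) (two_pi_pow_pos d).le
    _ = _ := by ring

/-- **`K_{n,l₁+l₂}(x) ≤ √K_{n,2l₁}(x) · √K_{n,2l₂}(x)`** (`d ≥ 2n+1`, any node `x`): log-convexity of
`K_{n,l}(x)` in `l` at a FIXED node. [folklore]
Device of [cite: FitznerVanDerHofstad2016NoBLE, (3.36) p. 1071, §5.2 (5.9), (5.11), (5.14) pp. 1091–1092] -/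
theorem srwK_le_sqrt_srwK_mul_srwK {n : ℕ} (hd : 2 * n + 1 ≤ d) (l₁ l₂ : ℕ) (x : Fin d → ℤ) :
    srwK d n (l₁ + l₂) x ≤ Real.sqrt (srwK d n (2 * l₁) x) * Real.sqrt (srwK d n (2 * l₂) x) := by
  have e : ∀ l : ℕ, (fun k : Fin d → ℝ => (|Dhat d k| ^ l * |DhatSym d x k|) * Chat d 1 k ^ n)
      = fun k => |Dhat d k| ^ l * (|DhatSym d x k| * Chat d 1 k ^ n) := fun l => funext fun k => mul_assoc _ _ _
  have h1 := integrable_srwK_integrand hd (2 * l₁) x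
  have h2 := integrable_srwK_integrand hd (2 * l₂) x
  rw [e] at h1 h2
  unfold srwK
  simp only [e]
  exact integral_abs_Dhat_pow_add_mul_le_sqrt
    (fun k => mul_nonneg (abs_nonneg _) (pow_nonneg (Chat_one_nonneg k) n)) l₁ l₂ h1 h2

/-- **`U_{n,l₁+l₂}(x) ≤ √U_{n,2l₁}(x) · √U_{n,2l₂}(x)`** (`d ≥ 2n+1`, any node `x`): log-convexity of
`U_{n,l}(x)` in `l` at a fixed node (`D̂^{sin} ≥ 0`). [folklore]
Device of [cite: FitznerVanDerHofstad2016NoBLE, (3.38) p. 1071, §5.2 (5.9), (5.11)–(5.12) pp. 1091–1092] -/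
theorem srwU_le_sqrt_srwU_mul_srwU {n : ℕ} (hd : 2 * n + 1 ≤ d) (l₁ l₂ : ℕ) (x : Fin d → ℤ) :
    srwU d n (l₁ + l₂) x ≤ Real.sqrt (srwU d n (2 * l₁) x) * Real.sqrt (srwU d n (2 * l₂) x) := by
  have e : ∀ l : ℕ, (fun k : Fin d → ℝ => (|Dhat d k| ^ l * |DhatSym d x k| * Dsin d k) * Chat d 1 k ^ n)
      = fun k => |Dhat d k| ^ l * (|DhatSym d x k| * Dsin d k * Chat d 1 k ^ n) := fun l => funext fun k => by ring
  have h1 := integrable_srwU_integrand hd (2 * l₁) x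
  have h2 := integrable_srwU_integrand hd (2 * l₂) x
  rw [e] at h1 h2
  unfold srwU
  simp only [e]
  exact integral_abs_Dhat_pow_add_mul_le_sqrt
    (fun k => mul_nonneg (mul_nonneg (abs_nonneg _) (Dsin_nonneg k)) (pow_nonneg (Chat_one_nonneg k) n))
    l₁ l₂ h1 h2

/-- **`KM₂_{n,l₁+l₂}(x) ≤ √KM₂_{n,2l₁}(x) · √KM₂_{n,2l₂}(x)`** (`d ≥ 2n+1`, any node `x`). [folklore]
Device of [cite: FitznerVanDerHofstad2016NoBLE, (3.36)–(3.37) p. 1071, §5.2 (5.9), (5.14) p. 1092] -/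
theorem srwKM2_le_sqrt_srwKM2_mul_srwKM2 {n : ℕ} (hd : 2 * n + 1 ≤ d) (l₁ l₂ : ℕ) (x : Fin d → ℤ) :
    srwKM2 d n (l₁ + l₂) x ≤ Real.sqrt (srwKM2 d n (2 * l₁) x) * Real.sqrt (srwKM2 d n (2 * l₂) x) := by
  have e : ∀ l : ℕ, (fun k : Fin d → ℝ => (|Dhat d k| ^ l * |DhatSym d x k| * Mhat d k ^ 2) * Chat d 1 k ^ n)
      = fun k => |Dhat d k| ^ l * (|DhatSym d x k| * Mhat d k ^ 2 * Chat d 1 k ^ n) := fun l => funext fun k => by ring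
  have h1 := integrable_srwKM2_integrand hd (2 * l₁) x
  have h2 := integrable_srwKM2_integrand hd (2 * l₂) x
  rw [e] at h1 h2
  unfold srwKM2
  simp only [e]
  exact integral_abs_Dhat_pow_add_mul_le_sqrt
    (fun k => mul_nonneg (mul_nonneg (abs_nonneg _) (sq_nonneg _)) (pow_nonneg (Chat_one_nonneg k) n))
    l₁ l₂ h1 h2

/-! ### `ℚ`-cast closures: no `Real.sqrt` in an instance -/

/-- `√A · √B ≤ c` from `0 ≤ A ≤ a`, `B ≤ b`, `0 ≤ c`, `a · b ≤ c²` (`a b c : ℚ`). [folklore] -/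
private theorem sqrt_mul_sqrt_le_cast {A B : ℝ} {a b c : ℚ} (hA0 : 0 ≤ A) (hA : A ≤ (a : ℝ)) (hB : B ≤ (b : ℝ))
    (hc : 0 ≤ c) (h : a * b ≤ c ^ 2) : Real.sqrt A * Real.sqrt B ≤ (c : ℝ) := by
  have h1 : Real.sqrt A * Real.sqrt B ≤ Real.sqrt a * Real.sqrt b :=
    mul_le_mul (Real.sqrt_le_sqrt hA) (Real.sqrt_le_sqrt hB) (Real.sqrt_nonneg _) (Real.sqrt_nonneg _)
  refine h1.trans ?_
  have hc' : (0 : ℝ) ≤ (c : ℝ) := by exact_mod_cast hc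
  have h' : ((a : ℝ) * (b : ℝ)) ≤ (c : ℝ) ^ 2 := by exact_mod_cast h
  rw [← Real.sqrt_mul (hA0.trans hA), ← Real.sqrt_sq hc']
  exact Real.sqrt_le_sqrt h'

/-- **`K_{n,l₁+l₂}(x) ≤ c`** from rational cell bounds `K_{n,2l₁}(x) ≤ a`, `K_{n,2l₂}(x) ≤ b` and the
decidable `0 ≤ c`, `a b ≤ c²` (`d ≥ 2n+1`). [folklore]
Device of [cite: FitznerVanDerHofstad2016NoBLE, (3.36) p. 1071, §5.2 (5.9), (5.14) pp. 1091–1092] -/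
theorem srwK_le_cast_of_even {n : ℕ} (hd : 2 * n + 1 ≤ d) {l₁ l₂ : ℕ} {x : Fin d → ℤ} {a b c : ℚ}
    (ha : srwK d n (2 * l₁) x ≤ (a : ℝ)) (hb : srwK d n (2 * l₂) x ≤ (b : ℝ)) (hc : 0 ≤ c)
    (h : a * b ≤ c ^ 2) : srwK d n (l₁ + l₂) x ≤ (c : ℝ) :=
  (srwK_le_sqrt_srwK_mul_srwK hd l₁ l₂ x).trans (sqrt_mul_sqrt_le_cast (srwK_nonneg n _ x) ha hb hc h)

/-- **`U_{n,l₁+l₂}(x) ≤ c`** from `U_{n,2l₁}(x) ≤ a`, `U_{n,2l₂}(x) ≤ b`, `0 ≤ c`, `a b ≤ c²` (`d ≥ 2n+1`). [folklore]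
Device of [cite: FitznerVanDerHofstad2016NoBLE, (3.38) p. 1071, §5.2 (5.9), (5.12) pp. 1091–1092] -/
theorem srwU_le_cast_of_even {n : ℕ} (hd : 2 * n + 1 ≤ d) {l₁ l₂ : ℕ} {x : Fin d → ℤ} {a b c : ℚ}
    (ha : srwU d n (2 * l₁) x ≤ (a : ℝ)) (hb : srwU d n (2 * l₂) x ≤ (b : ℝ)) (hc : 0 ≤ c)
    (h : a * b ≤ c ^ 2) : srwU d n (l₁ + l₂) x ≤ (c : ℝ) :=
  (srwU_le_sqrt_srwU_mul_srwU hd l₁ l₂ x).trans (sqrt_mul_sqrt_le_cast (srwU_nonneg n _ x) ha hb hc h)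

/-- **`KM₂_{n,l₁+l₂}(x) ≤ c`** from `KM₂_{n,2l₁}(x) ≤ a`, `KM₂_{n,2l₂}(x) ≤ b`, `0 ≤ c`, `a b ≤ c²` (`d ≥ 2n+1`). [folklore]
Device of [cite: FitznerVanDerHofstad2016NoBLE, (3.36)–(3.37) p. 1071, §5.2 (5.9), (5.14) p. 1092] -/
theorem srwKM2_le_cast_of_even {n : ℕ} (hd : 2 * n + 1 ≤ d) {l₁ l₂ : ℕ} {x : Fin d → ℤ} {a b c : ℚ}
    (ha : srwKM2 d n (2 * l₁) x ≤ (a : ℝ)) (hb : srwKM2 d n (2 * l₂) x ≤ (b : ℝ)) (hc : 0 ≤ c)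
    (h : a * b ≤ c ^ 2) : srwKM2 d n (l₁ + l₂) x ≤ (c : ℝ) :=
  (srwKM2_le_sqrt_srwKM2_mul_srwKM2 hd l₁ l₂ x).trans
    (sqrt_mul_sqrt_le_cast (srwKM2_nonneg n _ x) ha hb hc h)

/-- **`T_{n,l₁+l₂}(x) ≤ c`** from `K_{n,2l₁}(x) ≤ a`, `KM₂_{n,2l₂}(x) ≤ b`, `0 ≤ c`, `a b ≤ c²` (`d ≥ 2n+1`;
the one-factor Cauchy–Schwarz `srwT_le_sqrt_srwK_mul_srwKM2` closed over `ℚ`).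
[cite: FitznerVanDerHofstad2016NoBLE, (3.37) p. 1071, §5.2 (5.9), (5.11) pp. 1091–1092] -/
theorem srwT_le_cast_of_srwK_srwKM2 {n : ℕ} (hd : 2 * n + 1 ≤ d) {l₁ l₂ : ℕ} {x : Fin d → ℤ} {a b c : ℚ}
    (ha : srwK d n (2 * l₁) x ≤ (a : ℝ)) (hb : srwKM2 d n (2 * l₂) x ≤ (b : ℝ)) (hc : 0 ≤ c)
    (h : a * b ≤ c ^ 2) : srwT d n (l₁ + l₂) x ≤ (c : ℝ) :=
  (srwT_le_sqrt_srwK_mul_srwKM2 hd l₁ l₂ x).trans (sqrt_mul_sqrt_le_cast (srwK_nonneg n _ x) ha hb hc h)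

/-! ### Named instances read by the atom assembler -/

/-- **Odd `l`: `K_{n,2j+1}(x) ≤ c`** from the even cells `K_{n,2j}(x) ≤ a`, `K_{n,2j+2}(x) ≤ b` at the same node
and `0 ≤ c`, `a b ≤ c²`. [folklore] Device of [cite: FitznerVanDerHofstad2016NoBLE, (3.36) p. 1071, §5.2 (5.9), (5.14) pp. 1091–1092] -/
theorem srwK_odd_le_cast {n : ℕ} (hd : 2 * n + 1 ≤ d) (j : ℕ) {x : Fin d → ℤ} {a b c : ℚ}
    (ha : srwK d n (2 * j) x ≤ (a : ℝ)) (hb : srwK d n (2 * j + 2) x ≤ (b : ℝ)) (hc : 0 ≤ c)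
    (h : a * b ≤ c ^ 2) : srwK d n (2 * j + 1) x ≤ (c : ℝ) := by
  rw [show 2 * j + 1 = j + (j + 1) by ring]
  rw [show 2 * j + 2 = 2 * (j + 1) by ring] at hb
  exact srwK_le_cast_of_even hd ha hb hc h

/-- **Odd `l`: `U_{n,2j+1}(x) ≤ c`** from `U_{n,2j}(x) ≤ a`, `U_{n,2j+2}(x) ≤ b`, `0 ≤ c`, `a b ≤ c²`. [folklore]
Device of [cite: FitznerVanDerHofstad2016NoBLE, (3.38) p. 1071, §5.2 (5.9), (5.12) pp. 1091–1092] -/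
theorem srwU_odd_le_cast {n : ℕ} (hd : 2 * n + 1 ≤ d) (j : ℕ) {x : Fin d → ℤ} {a b c : ℚ}
    (ha : srwU d n (2 * j) x ≤ (a : ℝ)) (hb : srwU d n (2 * j + 2) x ≤ (b : ℝ)) (hc : 0 ≤ c)
    (h : a * b ≤ c ^ 2) : srwU d n (2 * j + 1) x ≤ (c : ℝ) := by
  rw [show 2 * j + 1 = j + (j + 1) by ring]
  rw [show 2 * j + 2 = 2 * (j + 1) by ring] at hb
  exact srwU_le_cast_of_even hd ha hb hc h

/-- **`T_{n,0}(x) ≤ c`** from `K_{n,0}(x) ≤ a`, `KM₂_{n,0}(x) ≤ b`, `0 ≤ c`, `a b ≤ c²`.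
[cite: FitznerVanDerHofstad2016NoBLE, (3.37) p. 1071, §5.2 (5.9) p. 1091] -/
theorem srwT_zero_le_cast {n : ℕ} (hd : 2 * n + 1 ≤ d) {x : Fin d → ℤ} {a b c : ℚ}
    (ha : srwK d n 0 x ≤ (a : ℝ)) (hb : srwKM2 d n 0 x ≤ (b : ℝ)) (hc : 0 ≤ c) (h : a * b ≤ c ^ 2) :
    srwT d n 0 x ≤ (c : ℝ) := by
  simpa using srwT_le_cast_of_srwK_srwKM2 hd (l₁ := 0) (l₂ := 0) (by simpa using ha) (by simpa using hb) hc h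

/-- **`T_{n,1}(x) ≤ c`** from `K_{n,0}(x) ≤ a`, `KM₂_{n,2}(x) ≤ b` (the `K·D̂²M̂²` cell), `0 ≤ c`, `a b ≤ c²`.
[cite: FitznerVanDerHofstad2016NoBLE, (3.37) p. 1071, §5.2 (5.9), (5.11) pp. 1091–1092] -/
theorem srwT_one_le_cast_left {n : ℕ} (hd : 2 * n + 1 ≤ d) {x : Fin d → ℤ} {a b c : ℚ}
    (ha : srwK d n 0 x ≤ (a : ℝ)) (hb : srwKM2 d n 2 x ≤ (b : ℝ)) (hc : 0 ≤ c) (h : a * b ≤ c ^ 2) :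
    srwT d n 1 x ≤ (c : ℝ) := by
  simpa using srwT_le_cast_of_srwK_srwKM2 hd (l₁ := 0) (l₂ := 1) (by simpa using ha) (by simpa using hb) hc h

/-- **`T_{n,1}(x) ≤ c`** from `K_{n,2}(x) ≤ a`, `KM₂_{n,0}(x) ≤ b`, `0 ≤ c`, `a b ≤ c²`.
[cite: FitznerVanDerHofstad2016NoBLE, (3.37) p. 1071, §5.2 (5.9), (5.11) pp. 1091–1092] -/
theorem srwT_one_le_cast_right {n : ℕ} (hd : 2 * n + 1 ≤ d) {x : Fin d → ℤ} {a b c : ℚ}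
    (ha : srwK d n 2 x ≤ (a : ℝ)) (hb : srwKM2 d n 0 x ≤ (b : ℝ)) (hc : 0 ≤ c) (h : a * b ≤ c ^ 2) :
    srwT d n 1 x ≤ (c : ℝ) := by
  simpa using srwT_le_cast_of_srwK_srwKM2 hd (l₁ := 1) (l₂ := 0) (by simpa using ha) (by simpa using hb) hc h

/-- **`T_{n,2}(x) ≤ c`** from `K_{n,2}(x) ≤ a`, `KM₂_{n,2}(x) ≤ b`, `0 ≤ c`, `a b ≤ c²`.
[cite: FitznerVanDerHofstad2016NoBLE, (3.37) p. 1071, §5.2 (5.9) p. 1091] -/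
theorem srwT_two_le_cast {n : ℕ} (hd : 2 * n + 1 ≤ d) {x : Fin d → ℤ} {a b c : ℚ}
    (ha : srwK d n 2 x ≤ (a : ℝ)) (hb : srwKM2 d n 2 x ≤ (b : ℝ)) (hc : 0 ≤ c) (h : a * b ≤ c ^ 2) :
    srwT d n 2 x ≤ (c : ℝ) := by
  simpa using srwT_le_cast_of_srwK_srwKM2 hd (l₁ := 1) (l₂ := 1) (by simpa using ha) (by simpa using hb) hc h

end Literature.Probability.FitznerVanDerHofstad2017

end
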